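import Mathlib
import Summits.ValiantsHypothesis.ValiantsHypothesis.Theorems.BarrierLeverDefinableEquationsProductDepthSliceLevelOne

/-!
# Route BarrierLever — the MODEL axis of crux `DefinableEquations` (stmt-8745) / item
# `SingleSizeEquations` (stmt-8749): natural proofs at level ONE against circuits of UNBOUNDED
# product-depth `Δ(n) → ∞`, uniformly in the size exponent (val-np-p5 g10; memo R7, qualitative form)

g8/g9 (`LSTSlice.naturalProofsAgainstProductDepth_levelOne`): for every size exponent `b` and every
CONSTANT product-depth `Δ ≥ 1` there is `n₀(b, Δ)` such that for `n ≥ n₀` the degree-`≤ n`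
polynomials with a product-depth-`Δ` circuit of `≤ n^b` gates are not a succinct hitting set for
`Distinguishers ℂ n 1`.  By a DIAGONAL choice of the depth this gives one depth function growing to
infinity that serves all `b` at once:

**Theorem (`naturalProofsAgainstUnboundedProductDepth`).**  There is `Δ : ℕ → ℕ` with
`Δ(n) → ∞` (and `Δ(n) ≥ 1`) such that for EVERY `b`, eventually in `n`, the class of degree-`≤ n`
polynomials computed by circuits (any fan-in) of size `≤ n^b` and product-depth `≤ Δ(n)` is not a
succinct hitting set for `Distinguishers ℂ n 1` — level one, `q = 0`; `…_equations` is the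
Boolean-sum rendering in the crux's format, with the `∃ a ∀ b` quantifier order of
`DefinableEquations`.

Proof (pure logic over the landed slice): with `N(b, Δ)` the thresholds of the level-one slice
(for depth `Δ + 1`) put `T(m) = max_{b, Δ ≤ m} N(b, Δ)` and let `Δ₀(n)` be the largest `m ≤ n` with
`T(m) ≤ n` (`Nat.findGreatest`); then `Δ₀(n) ≥ m` as soon as `n ≥ max(m, T(m))` (so `Δ₀ → ∞`),
`T(Δ₀(n)) ≤ n` for `n ≥ T(0)`, hence `N(b, Δ₀(n)) ≤ n` once moreover `Δ₀(n) ≥ b`; take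
`Δ(n) = Δ₀(n) + 1`.

HONEST SCOPE: `Δ` is obtained by choice from the slice's thresholds and NO RATE is claimed (LST's
analysis gives product-depth `o(log log log n)`; making the tree's `final_arith` constants explicit
— memo R7 proper — would give `Δ(n) ≈ ½ log₇ log₂ log₂ n`, not done here).  What this is NOT:
nothing on general circuits (the crux, b = 2 OPEN — Chatterjee–Tengse §1.3 dir. 2; and see the
wall `…ProductDepthWall.lean`: the same certificates die on `SmallCircuits ℂ n 5`) and nothing on
`VP ≠ VNP`.  No definitions, no named facts, standard axioms.
Refs: Limaye–Srinivasan–Tavenas, J. ACM 72 (2025) Art. 26, Cor. 4; Forbes–Shpilka–Volk 2018 Def. 1/3.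
-/

-- `Summit.ValiantsHypothesis.ValiantsHypothesis.…` repeats a component by the D-0017 layout
-- (single-conjunct summit), which the `dupNamespace` linter flags; the name is mandated.
set_option linter.dupNamespace false

noncomputable section

namespace Summit.ValiantsHypothesis.ValiantsHypothesis.Theorems.BarrierLeverDefinableEquations

open MvPolynomial Filter
open Literature.Computability.AlgebraicComplexity Literature.Barriers.ValiantsHypothesis
open scoped BigOperators

namespace LSTSlice

/-- **Diagonalisation lemma** (pure logic): given thresholds `N b Δ` beyond which a property
`P b Δ n` holds, there is ONE function `Δ₀ : ℕ → ℕ` tending to infinity with `P b (Δ₀ n) n` for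
every `b`, eventually in `n`. [folklore] -/
theorem exists_diagonal {P : ℕ → ℕ → ℕ → Prop} (N : ℕ → ℕ → ℕ)
    (hN : ∀ b Δ n, N b Δ ≤ n → P b Δ n) :
    ∃ Δ₀ : ℕ → ℕ, Tendsto Δ₀ atTop atTop ∧ ∀ b, ∃ n₀, ∀ n ≥ n₀, P b (Δ₀ n) n := by
  classical
  -- `T m` dominates all thresholds with indices `≤ m`
  set T : ℕ → ℕ := fun m => ((Finset.range (m + 1)) ×ˢ (Finset.range (m + 1))).sup
    (fun p => N p.1 p.2) with hT
  have hNT : ∀ b Δ m, b ≤ m → Δ ≤ m → N b Δ ≤ T m := by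
    intro b Δ m hb hΔ
    have hmem : (b, Δ) ∈ (Finset.range (m + 1)) ×ˢ (Finset.range (m + 1)) := by
      simp only [Finset.mem_product, Finset.mem_range]; omega
    exact Finset.le_sup (f := fun p : ℕ × ℕ => N p.1 p.2) hmem
  -- the diagonal depth
  set Δ₀ : ℕ → ℕ := fun n => Nat.findGreatest (fun m => T m ≤ n) n with hΔ₀
  have hge : ∀ m n, m ≤ n → T m ≤ n → m ≤ Δ₀ n := fun m n hmn hTm =>
    Nat.le_findGreatest hmn hTm
  have hspec : ∀ n, T 0 ≤ n → T (Δ₀ n) ≤ n := by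
    intro n h0
    by_cases hz : Δ₀ n = 0
    · rw [hz]; exact h0
    · have hfg : Nat.findGreatest (fun m => T m ≤ n) n = Δ₀ n := by simp only [hΔ₀]
      exact Nat.findGreatest_of_ne_zero (P := fun m => T m ≤ n) hfg hz
  refine ⟨Δ₀, ?_, fun b => ?_⟩
  · rw [tendsto_atTop_atTop]
    intro m
    exact ⟨max m (T m), fun n hn => hge m n (le_trans (le_max_left _ _) hn)
      (le_trans (le_max_right _ _) hn)⟩
  · refine ⟨max (T 0) (max b (T b)), fun n hn => hN b (Δ₀ n) n ?_⟩
    have h0 : T 0 ≤ n := le_trans (le_max_left _ _) hn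
    have hb : b ≤ Δ₀ n := hge b n (le_trans (le_trans (le_max_left _ _) (le_max_right _ _)) hn)
      (le_trans (le_trans (le_max_right _ _) (le_max_right _ _)) hn)
    exact (hNT b (Δ₀ n) (Δ₀ n) hb le_rfl).trans (hspec n h0)

/-- **Natural proofs at level one against circuits of UNBOUNDED product-depth.**  There is a depth
function `Δ : ℕ → ℕ`, `Δ(n) → ∞`, `Δ(n) ≥ 1`, such that for every size exponent `b`, eventually in
`n`, the degree-`≤ n` polynomials computed by circuits of size `≤ n^b` and product-depth `≤ Δ(n)`
are NOT a succinct hitting set for `Distinguishers ℂ n 1`.  (Diagonal over the constant-depth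
slice; no rate claimed.) [cite: LimayeSrinivasanTavenas2025, Cor. 4] -/
theorem naturalProofsAgainstUnboundedProductDepth :
    ∃ Δ : ℕ → ℕ, Tendsto Δ atTop atTop ∧ (∀ n, 1 ≤ Δ n) ∧
      ∀ b : ℕ, ∃ n₀ : ℕ, ∀ n ≥ n₀, ¬ IsSuccinctHittingSet (degLEMonomials n)
        {f : MvPolynomial (Fin n) ℂ | f.totalDegree ≤ n ∧
          ∃ P : ArithCircuit ℂ (Fin n), P.Computes f ∧ P.size ≤ n ^ b ∧ P.productDepth ≤ Δ n}
        (Distinguishers ℂ n 1) := by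
  classical
  -- thresholds of the level-one slice for depth `Δ + 1`
  have hslice : ∀ b Δ : ℕ, ∃ n₀ : ℕ, ∀ n ≥ n₀, ¬ IsSuccinctHittingSet (degLEMonomials n)
      {f : MvPolynomial (Fin n) ℂ | f.totalDegree ≤ n ∧
        ∃ P : ArithCircuit ℂ (Fin n), P.Computes f ∧ P.size ≤ n ^ b ∧ P.productDepth ≤ Δ + 1}
      (Distinguishers ℂ n 1) :=
    fun b Δ => naturalProofsAgainstProductDepth_levelOne b (Δ + 1) (Nat.le_add_left 1 Δ)
  choose N hN using hslice
  obtain ⟨Δ₀, htend, hev⟩ := exists_diagonal (P := fun b Δ n => ¬ IsSuccinctHittingSet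
      (degLEMonomials n)
      {f : MvPolynomial (Fin n) ℂ | f.totalDegree ≤ n ∧
        ∃ P : ArithCircuit ℂ (Fin n), P.Computes f ∧ P.size ≤ n ^ b ∧ P.productDepth ≤ Δ + 1}
      (Distinguishers ℂ n 1)) N (fun b Δ n h => hN b Δ n h)
  refine ⟨fun n => Δ₀ n + 1, ?_, fun n => Nat.le_add_left 1 _, fun b => ?_⟩
  · exact tendsto_atTop_atTop.2 fun m => by
      obtain ⟨i, hi⟩ := tendsto_atTop_atTop.1 htend m
      exact ⟨i, fun n hn => (hi n hn).trans (Nat.le_succ _)⟩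
  · exact hev b

/-- **Boolean-sum rendering, `∃ a ∀ b` shape**: ONE level `a = 1` and ONE depth function
`Δ(n) → ∞` such that for every `b`, eventually in `n`, a datum `H` with `q = 0` Boolean variables,
`L(H), deg H ≤ C(2n,n)`, `boolSum H ≠ 0`, vanishes at `coeff(f)` for every `f` of degree `≤ n`
with a circuit of size `≤ n^b` and product-depth `≤ Δ(n)` — `DefinableEquations` with
`SmallCircuits ℂ n b` cut down to product-depth `Δ(n)`.
[cite: LimayeSrinivasanTavenas2025, Cor. 4] [cite: ForbesShpilkaVolk2018, Def. 1] -/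
theorem unboundedProductDepthEquations :
    ∃ a : ℕ, ∃ Δ : ℕ → ℕ, Tendsto Δ atTop atTop ∧ (∀ n, 1 ≤ Δ n) ∧
      ∀ b : ℕ, ∃ n₀ : ℕ, ∀ n ≥ n₀, ∃ q : ℕ, q ≤ Nat.choose (2 * n) n ^ a ∧
        ∃ H : MvPolynomial (↥(degLEMonomials n) ⊕ Fin q) ℂ,
          complexity H ≤ Nat.choose (2 * n) n ^ a ∧ H.totalDegree ≤ Nat.choose (2 * n) n ^ a ∧
          boolSum H ≠ 0 ∧
          ∀ f : MvPolynomial (Fin n) ℂ, f.totalDegree ≤ n →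
            (∃ P : ArithCircuit ℂ (Fin n), P.Computes f ∧ P.size ≤ n ^ b ∧ P.productDepth ≤ Δ n) →
            eval (coeffVector (degLEMonomials n) f) (boolSum H) = 0 := by
  obtain ⟨Δ, htend, h1, h⟩ := naturalProofsAgainstUnboundedProductDepth
  refine ⟨1, Δ, htend, h1, fun b => ?_⟩
  obtain ⟨n₀, hn₀⟩ := h b
  refine ⟨n₀, fun n hn => ?_⟩
  obtain ⟨D, hD, hD0, hvan⟩ := (exists_isNaturalProof_iff _ _ _).mpr (hn₀ n hn)
  have hbs : boolSum (m := 0) (MvPolynomial.rename Sum.inl D) = D := by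
    rw [boolSum, Fintype.sum_unique, MvPolynomial.aeval_rename, Sum.elim_comp_inl,
      MvPolynomial.aeval_X_left, AlgHom.coe_id, id_eq]
  refine ⟨0, Nat.zero_le _, MvPolynomial.rename Sum.inl D, ?_, ?_, ?_, fun f hf hP => ?_⟩
  · exact (complexity_rename_le_holds' _ _).trans hD.1
  · exact (MvPolynomial.totalDegree_rename_le _ _).trans hD.2
  · rwa [hbs]
  · rw [hbs]; exact hvan f ⟨hf, hP⟩

/-- **Sub-slice of the crux's class**: for the same `Δ`, for every `b`, eventually in `n`, the
FAN-IN-TWO members of `SmallCircuits ℂ n b` whose optimal-size circuit may be taken of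
product-depth `≤ Δ(n)` — i.e. `{f ∈ SmallCircuits ℂ n b | some fan-in-two circuit of size ≤ n^b
and product-depth ≤ Δ(n) computes f}` — are not a succinct hitting set for `Distinguishers ℂ n 1`.
[cite: ForbesShpilkaVolk2018, Cor. 5] -/
theorem naturalProofsAgainstUnboundedProductDepth_smallCircuits :
    ∃ Δ : ℕ → ℕ, Tendsto Δ atTop atTop ∧ (∀ n, 1 ≤ Δ n) ∧
      ∀ b : ℕ, ∃ n₀ : ℕ, ∀ n ≥ n₀, ¬ IsSuccinctHittingSet (degLEMonomials n)
        {f : MvPolynomial (Fin n) ℂ | f ∈ SmallCircuits ℂ n b ∧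
          ∃ P : ArithCircuit ℂ (Fin n), P.IsFanInTwo ∧ P.Computes f ∧ P.size ≤ n ^ b ∧
            P.productDepth ≤ Δ n}
        (Distinguishers ℂ n 1) := by
  obtain ⟨Δ, htend, h1, h⟩ := naturalProofsAgainstUnboundedProductDepth
  refine ⟨Δ, htend, h1, fun b => ?_⟩
  obtain ⟨n₀, hn₀⟩ := h b
  refine ⟨n₀, fun n hn hhit => hn₀ n hn (hhit.mono ?_ le_rfl)⟩
  rintro f ⟨hf, P, -, hPf, hPs, hPΔ⟩
  exact ⟨hf.1, P, hPf, hPs, hPΔ⟩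

end LSTSlice

end Summit.ValiantsHypothesis.ValiantsHypothesis.Theorems.BarrierLeverDefinableEquations
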